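import Summits.Ventures.CertifiedManyBodySolver.Observables.RungLeavesCoverageNdNiO2ResidualDensityBundlesCaps
import HarnessLib

/-!
# Ventures/CertifiedManyBodySolver — Observables/RungLeavesCoverageNdNiO2ResidualDensityBundlesPieces.lean

HONEST FRAMING: one-sided certified CEILINGS on the uniform flux stiffness on the DOWNFOLDED d⁹-nickelate box of record `boxNdNiO2E_M21` (NdNiO₂ parent
film; router/BOXES/NdNiO2.md «1BH+3BE», SCREENING-GRADE) — wording class (xx1): CONTROL / CALIBRATION + labelled heuristic; a ceiling never speaks to the
presence of superconductivity; never «certified true negative / positive»; not a `T_c` or phase-diagram statement; no summit statement is proved here.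
CONDITIONAL closers only: every conclusion is conditional BY NAME on the families / rows / cap tables it names; floors node-free; no number of record is
asserted; no `sorry`; no definition; zero compute.

Cells `pub/hubbard-obs` ∧ `pub/hubbard-downfold` (MO-S2 ∧ MO-S1, D-0154 (1)(C) COVERAGE material (iii) NdNiO₂), seat `hubbard-cov-ndnio2-unc-3`
(`prover-hubbard-cov-ndnio2-unc-3-g3-0`; funnel custodian, captain D12; write_cruxes stmt-Ventures-26751 `ResidualLowUSlab` / stmt-Ventures-26752
`ResidualHighUSlab` of route-Ventures-CovNdNiO2M21 — SUPPORT, no claim). Sixth part of `Observables/RungLeavesCoverageNdNiO2ResidualDensityBundles{,High,Caps,Box,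
TwoStations}.lean` — SPLIT / MIXED-FORMAT INSURANCE. THE POINT. Parts 1–3 close the two cruxes from ONE bundle row per (segment, objective); part 4 from ONE constant
value per (segment, objective). The captain's instrument of record (D14) is one pinned-pair read per (segment, objective), with the standing fallback «pin at the
mid-vertex (level-1 pin) if a pinned read fails its margin» (D14 (3); midpoint parents A-mid `−2039/3400`, B-mid `−101/200`, C-mid `−9/20` fired, obs l.3101) — after
which ONE segment carries TWO sub-bundles for one objective while the others keep one. So this file states the two closers ONCE over the weakest currency that
still keeps each producer object whole — a PRICED FAMILY per (segment, objective): any `v : ℝ → ℝ → ℝ` with (i) `v x s ≤ |D₄|⁻¹ Σ_γ Re ω_γ(Γ_γ(−X₀(σ,5)))` on the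
torus-limit ground-state class at every `(s, 5, x)` of segment × R‴ and (ii) `−v x s ≤ c` there — and the three moves that build such families:

* §14 `pricedFamily_of_bundleRowWN_capTable` (generic station `U_A ≥ 0`, generic constant observable): ONE bundle row `TPrimeBundleOrbitLowerRowWN U_A s₁ s₂ lo hi F
  sl₁ sl₂ (477/500) (fun _ => X)` used on a sub-segment `[a, b] ⊆ [s₁, s₂]` + a cap TABLE in the producers' binder shape covering `[a, b]` + the two literal
  thresholds (`lo ≤ min(4a, −4(1+b))·477/500` = band bottom on the sub-rectangle, node-free; `C ≤ hi`) ⇒ the family `wnBundleValue F sl₁ sl₂ (477/500)` on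
  `[a, b] × R‴` (the adapter announced as `constFamily_of_bundleRowWN` in part 4's docstring, in family form; the price side is part 1's
  `neg_wnBundleValue_le_on_R3_of_ends`);
* §15 `orbitFamily_glue` / `orbitPrice_glue`: pieces on `[a, m]` and `[m, b]` ⇒ the piecewise family `if s ≤ m then v₁ x s else v₂ x s` on `[a, b]` and its price — iterate for
  any number of sub-bundles of one segment (a split segment never changes the closer, only adds one glue line);
* §16 `ndM21_residualHighUSlab_of_pricedFamilies` (four priced families: `P = −X₀(−23/50, 5)`, `Q = −X₀(−11/25, 5)` × A `[−276/425, −11/20]`, B `[−11/20, −176/325]`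
  × R‴) and `ndM21_residualLowUSlab_of_pricedFamilies` (six: × A′ `[−184/325, −11/20]`, B′ `[−11/20, −23/50]`, C `[−23/50, −11/25]`), `c ≤ 4779578/10⁷` ⇒ LITERALLY the
  statements of `Theses.CovNdNiO2M21.ResidualHighUSlab` / `.ResidualLowUSlab` (composition verbatim as parts 1–2: density split at `183/200` by box-2's
  `ndnio2_M21_lowFillingCell183_below_bar`, then box-2's / unc-2's apex-station two-END-objective theorems with `(U_A, U₁, U_max) = (5, 13/2, 17/2)` resp.
  `(U_A, U_max) = (5, 13/2)` and the σ-chord price). Parts 1–4's closers are the one-piece special cases.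

NOT said: that any bundle certificate exists; whether any segment will be split; which cap tier (captain D16) keys which row; a number of record; anything
toward smaller `U`.

References: S. Boyd, L. Vandenberghe, *Convex Optimization* (2004) §5.9 [BoydVandenberghe2004]; T. Koma, H. Tasaki, J. Stat. Phys. 76 (1994) 745, §1
[KomaTasaki1994]; D. J. Scalapino, S. R. White, S.-C. Zhang, PRB 47 (1993) 7995, §II [ScalapinoWhiteZhang1993]; E. H. Lieb, M. Loss, Duke Math. J. 71 (1993)
337, §8 Thm 8.2 [LiebLoss1993]; R. B. Israel, *Convexity in the Theory of Lattice Gases* (1979) Thm. I.3.4 [Israel1979].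
-/

noncomputable section

namespace Summit.Ventures.CertifiedManyBodySolver.Observables

open Set Filter Topology
open Summit.Ventures.CertifiedManyBodySolver.Downfold
open Summit.Ventures.CertifiedManyBodySolver.Certificates
open Literature.MathematicalPhysics.QuantumLattice Literature.MathematicalPhysics.QuantumLattice.ThermodynamicLimit
open Literature.Probability.LatticeModels
open Matrix HubbardWave0
open scoped BigOperators ComplexOrder

/-! ## §14 One bundle row + one cap table ⇒ a priced family on a sub-segment × R‴ -/

section Pieces

variable {UA : ℝ}

/-- **BUNDLE ROW + CAP TABLE ⇒ FAMILY ON A SUB-SEGMENT × R‴** (generic station `U_A ≥ 0`, constant observable `X`). The row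
`TPrimeBundleOrbitLowerRowWN U_A s₁ s₂ lo hi F sl₁ sl₂ (477/500) (fun _ => X)` used on `[a, b] ⊆ [s₁, s₂]`; a cap table in binder shape
(`∀ U s n, 0 ≤ U → U ≤ U_A → α ≤ s → s ≤ β → n₁ ≤ n → n ≤ 477/500 → e₀(1,s,U,n) ≤ C`) with `α ≤ a`, `b ≤ β`, `n₁ ≤ 183/200`; thresholds `C ≤ hi` and
`lo ≤ min(4a, −4(1+b))·(477/500)` (band bottom on the sub-rectangle, node-free) ⇒ `wnBundleValue F sl₁ sl₂ (477/500) x ≤ |D₄|⁻¹ Σ_γ Re ω_γ(Γ_γ X)` on the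
torus-limit ground-state class at every `(s, U_A, x) ∈ [a, b] × {U_A} × R‴`. [cite: BoydVandenberghe2004, §5.9] [cite: LiebLoss1993, §8, Theorem 8.2] -/
theorem pricedFamily_of_bundleRowWN_capTable (hUA : 0 ≤ UA) {s₁ s₂ a b α β n₁ C : ℝ} {lo hi F sl₁ sl₂ : ℚ}
    {X : FermionOp (Literature.Probability.LatticeModels.box 2 7)}
    (h : TPrimeBundleOrbitLowerRowWN UA s₁ s₂ lo hi F sl₁ sl₂ (477 / 500) (fun _ => X)) (ha : s₁ ≤ a) (hb : b ≤ s₂)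
    (hcap : ∀ U s n : ℝ, 0 ≤ U → U ≤ UA → α ≤ s → s ≤ β → n₁ ≤ n → n ≤ 477 / 500 → energyDensityTT' 1 s U n ≤ C)
    (hα : α ≤ a) (hβ : b ≤ β) (hn₁ : n₁ ≤ 183 / 200)
    (hlo : ((lo : ℚ) : ℝ) ≤ min (4 * a) (-(4 * (1 + b))) * (477 / 500)) (hhi : C ≤ ((hi : ℚ) : ℝ)) :
    ∀ x ∈ Set.Icc (183 / 200 : ℝ) (477 / 500), ∀ s ∈ Set.Icc a b,
      ∀ (ω : InfVolFermionState 2) (Ls : ℕ → ℕ) (ψ : ∀ L, Fock (Orb (FermionTorus 2 L))),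
      Tendsto Ls atTop atTop →
      (∀ j, IsGroundStateInSector (hubbardTorusTT' (Ls j) 1 s UA) (rectN x (Ls j)) 0 (ψ (Ls j))) →
      (∀ j, star (ψ (Ls j)) ⬝ᵥ ψ (Ls j) = 1) → ω.IsTorusLimitOf ψ Ls →
      wnBundleValue F sl₁ sl₂ (477 / 500) x ≤ ((Finset.univ : Finset (DihedralGroup 4)).card : ℝ)⁻¹ *
        ∑ g ∈ (Finset.univ : Finset (DihedralGroup 4)),
          (ω.expect (d4ShiftSet g 0 (Literature.Probability.LatticeModels.box 2 7))
            (fermionEmbed (PolySite.d4Emb g 0 (Literature.Probability.LatticeModels.box 2 7)) X)).re := by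
  have x0 : (0 : ℝ) ≤ 183 / 200 := by norm_num
  have x2 : (477 / 500 : ℝ) < 2 := by norm_num
  have hcap' : ∀ s ∈ Set.Icc a b, ∀ x ∈ Set.Icc (183 / 200 : ℝ) (477 / 500), energyDensityTT' 1 s UA x ≤ ((hi : ℚ) : ℝ) :=
    fun s hs x hx => (hcap UA s x hUA le_rfl (hα.trans hs.1) (hs.2.trans hβ) (hn₁.trans hx.1) hx.2).trans hhi
  intro x hx s hs ω Ls ψ hLs hψ h1 hω
  exact orbitLowerOn_subrect_of_bundleRowWN_bandBottom hUA h ha hb x0 x2 hlo hcap' x hx s hs ω Ls ψ hLs hψ h1 hω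

/-- **PRICE OF ONE ROW ON A SUB-SEGMENT × R‴** (the `s`-independent price of part 1 restated in family form): the three rational end inequalities
`−F − sl_j·(183/200 − 477/500) ≤ c` (`j = 1, 2`), `−F ≤ c` ⇒ `−wnBundleValue F sl₁ sl₂ (477/500) x ≤ c` at every `(x, s) ∈ R‴ × [a, b]`. [cite: Israel1979, Thm. I.3.4] -/
theorem price_of_bundleRowWN_ends {F sl₁ sl₂ c : ℚ} {a b : ℝ}
    (p : -F - sl₁ * (183 / 200 - 477 / 500) ≤ c ∧ -F - sl₂ * (183 / 200 - 477 / 500) ≤ c ∧ -F ≤ c) :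
    ∀ x ∈ Set.Icc (183 / 200 : ℝ) (477 / 500), ∀ s ∈ Set.Icc a b, -wnBundleValue F sl₁ sl₂ (477 / 500) x ≤ ((c : ℚ) : ℝ) :=
  fun x hx _ _ => neg_wnBundleValue_le_on_R3_of_ends p.1 p.2.1 p.2.2 x hx

/-! ## §15 Gluing pieces of one segment (families and prices) -/

/-- **GLUE TWO ADJACENT `s`-PIECES OF A FAMILY** (same station `U_A`, same constant observable `X`): families `v₁` on `[a, m] × R‴` and `v₂` on `[m, b] × R‴` ⇒ the
piecewise family `if s ≤ m then v₁ x s else v₂ x s` on `[a, b] × R‴`. Iterate for three or more pieces. [cite: BoydVandenberghe2004, §5.9] -/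
theorem orbitFamily_glue {a m b : ℝ} {v₁ v₂ : ℝ → ℝ → ℝ} {X : FermionOp (Literature.Probability.LatticeModels.box 2 7)}
    (h₁ : ∀ x ∈ Set.Icc (183 / 200 : ℝ) (477 / 500), ∀ s ∈ Set.Icc a m,
      ∀ (ω : InfVolFermionState 2) (Ls : ℕ → ℕ) (ψ : ∀ L, Fock (Orb (FermionTorus 2 L))),
      Tendsto Ls atTop atTop →
      (∀ j, IsGroundStateInSector (hubbardTorusTT' (Ls j) 1 s UA) (rectN x (Ls j)) 0 (ψ (Ls j))) →
      (∀ j, star (ψ (Ls j)) ⬝ᵥ ψ (Ls j) = 1) → ω.IsTorusLimitOf ψ Ls →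
      v₁ x s ≤ ((Finset.univ : Finset (DihedralGroup 4)).card : ℝ)⁻¹ * ∑ g ∈ (Finset.univ : Finset (DihedralGroup 4)),
        (ω.expect (d4ShiftSet g 0 (Literature.Probability.LatticeModels.box 2 7))
          (fermionEmbed (PolySite.d4Emb g 0 (Literature.Probability.LatticeModels.box 2 7)) X)).re)
    (h₂ : ∀ x ∈ Set.Icc (183 / 200 : ℝ) (477 / 500), ∀ s ∈ Set.Icc m b,
      ∀ (ω : InfVolFermionState 2) (Ls : ℕ → ℕ) (ψ : ∀ L, Fock (Orb (FermionTorus 2 L))),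
      Tendsto Ls atTop atTop →
      (∀ j, IsGroundStateInSector (hubbardTorusTT' (Ls j) 1 s UA) (rectN x (Ls j)) 0 (ψ (Ls j))) →
      (∀ j, star (ψ (Ls j)) ⬝ᵥ ψ (Ls j) = 1) → ω.IsTorusLimitOf ψ Ls →
      v₂ x s ≤ ((Finset.univ : Finset (DihedralGroup 4)).card : ℝ)⁻¹ * ∑ g ∈ (Finset.univ : Finset (DihedralGroup 4)),
        (ω.expect (d4ShiftSet g 0 (Literature.Probability.LatticeModels.box 2 7))
          (fermionEmbed (PolySite.d4Emb g 0 (Literature.Probability.LatticeModels.box 2 7)) X)).re) :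
    ∀ x ∈ Set.Icc (183 / 200 : ℝ) (477 / 500), ∀ s ∈ Set.Icc a b,
      ∀ (ω : InfVolFermionState 2) (Ls : ℕ → ℕ) (ψ : ∀ L, Fock (Orb (FermionTorus 2 L))),
      Tendsto Ls atTop atTop →
      (∀ j, IsGroundStateInSector (hubbardTorusTT' (Ls j) 1 s UA) (rectN x (Ls j)) 0 (ψ (Ls j))) →
      (∀ j, star (ψ (Ls j)) ⬝ᵥ ψ (Ls j) = 1) → ω.IsTorusLimitOf ψ Ls →
      (if s ≤ m then v₁ x s else v₂ x s) ≤ ((Finset.univ : Finset (DihedralGroup 4)).card : ℝ)⁻¹ * ∑ g ∈ (Finset.univ : Finset (DihedralGroup 4)),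
        (ω.expect (d4ShiftSet g 0 (Literature.Probability.LatticeModels.box 2 7))
          (fermionEmbed (PolySite.d4Emb g 0 (Literature.Probability.LatticeModels.box 2 7)) X)).re := by
  intro x hx s hs ω Ls ψ hLs hψ h1 hω
  by_cases hsm : s ≤ m
  · simp only [if_pos hsm]; exact h₁ x hx s ⟨hs.1, hsm⟩ ω Ls ψ hLs hψ h1 hω
  · simp only [if_neg hsm]; exact h₂ x hx s ⟨(not_le.1 hsm).le, hs.2⟩ ω Ls ψ hLs hψ h1 hω

/-- **GLUE TWO ADJACENT `s`-PIECES OF A PRICE**: `−v₁ x s ≤ c` on `R‴ × [a, m]` and `−v₂ x s ≤ c` on `R‴ × [m, b]` ⇒ `−(if s ≤ m then v₁ x s else v₂ x s) ≤ c` on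
`R‴ × [a, b]`. [folklore] -/
theorem orbitPrice_glue {a m b c : ℝ} {v₁ v₂ : ℝ → ℝ → ℝ}
    (p₁ : ∀ x ∈ Set.Icc (183 / 200 : ℝ) (477 / 500), ∀ s ∈ Set.Icc a m, -v₁ x s ≤ c)
    (p₂ : ∀ x ∈ Set.Icc (183 / 200 : ℝ) (477 / 500), ∀ s ∈ Set.Icc m b, -v₂ x s ≤ c) :
    ∀ x ∈ Set.Icc (183 / 200 : ℝ) (477 / 500), ∀ s ∈ Set.Icc a b, -(if s ≤ m then v₁ x s else v₂ x s) ≤ c := by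
  intro x hx s hs
  by_cases hsm : s ≤ m
  · simp only [if_pos hsm]; exact p₁ x hx s ⟨hs.1, hsm⟩
  · simp only [if_neg hsm]; exact p₂ x hx s ⟨(not_le.1 hsm).le, hs.2⟩

/-- **RESTRICT / WEAKEN A FAMILY**: a family `v` on `[a, b] × R‴` is a family on any `[a', b'] ⊆ [a, b]`. [folklore] -/
theorem orbitFamily_mono {a b a' b' : ℝ} {v : ℝ → ℝ → ℝ} {X : FermionOp (Literature.Probability.LatticeModels.box 2 7)}
    (h : ∀ x ∈ Set.Icc (183 / 200 : ℝ) (477 / 500), ∀ s ∈ Set.Icc a b,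
      ∀ (ω : InfVolFermionState 2) (Ls : ℕ → ℕ) (ψ : ∀ L, Fock (Orb (FermionTorus 2 L))),
      Tendsto Ls atTop atTop →
      (∀ j, IsGroundStateInSector (hubbardTorusTT' (Ls j) 1 s UA) (rectN x (Ls j)) 0 (ψ (Ls j))) →
      (∀ j, star (ψ (Ls j)) ⬝ᵥ ψ (Ls j) = 1) → ω.IsTorusLimitOf ψ Ls →
      v x s ≤ ((Finset.univ : Finset (DihedralGroup 4)).card : ℝ)⁻¹ * ∑ g ∈ (Finset.univ : Finset (DihedralGroup 4)),
        (ω.expect (d4ShiftSet g 0 (Literature.Probability.LatticeModels.box 2 7))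
          (fermionEmbed (PolySite.d4Emb g 0 (Literature.Probability.LatticeModels.box 2 7)) X)).re)
    (ha : a ≤ a') (hb : b' ≤ b) :
    ∀ x ∈ Set.Icc (183 / 200 : ℝ) (477 / 500), ∀ s ∈ Set.Icc a' b',
      ∀ (ω : InfVolFermionState 2) (Ls : ℕ → ℕ) (ψ : ∀ L, Fock (Orb (FermionTorus 2 L))),
      Tendsto Ls atTop atTop →
      (∀ j, IsGroundStateInSector (hubbardTorusTT' (Ls j) 1 s UA) (rectN x (Ls j)) 0 (ψ (Ls j))) →
      (∀ j, star (ψ (Ls j)) ⬝ᵥ ψ (Ls j) = 1) → ω.IsTorusLimitOf ψ Ls →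
      v x s ≤ ((Finset.univ : Finset (DihedralGroup 4)).card : ℝ)⁻¹ * ∑ g ∈ (Finset.univ : Finset (DihedralGroup 4)),
        (ω.expect (d4ShiftSet g 0 (Literature.Probability.LatticeModels.box 2 7))
          (fermionEmbed (PolySite.d4Emb g 0 (Literature.Probability.LatticeModels.box 2 7)) X)).re :=
  fun x hx s hs => h x hx s ⟨ha.trans hs.1, hs.2.trans hb⟩

end Pieces

/-! ## §16 The two cruxes from PRICED FAMILIES (station `U_A = 5`; one family per (segment, objective), each of any provenance / any number of pieces) -/

section PricedFamilies

/-- **`ResidualHighUSlab` FROM FOUR PRICED FAMILIES** (station 5, edition E-R; `P = −X₀(−23/50, 5)`, `Q = −X₀(−11/25, 5)`; segments A `[−276/425, −11/20]`, B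
`[−11/20, −176/325]` × R‴ = `[183/200, 477/500]`): families `vPA, vQA, vPB, vQB : ℝ → ℝ → ℝ` (arguments `x s`) that are orbit-lower bounds on the torus-limit ground-state
class at every `(s, 5, x)` of their rectangle, prices `−v x s ≤ c` there, `c ≤ 4779578/10⁷` ⇒ LITERALLY the statement of `Theses.CovNdNiO2M21.ResidualHighUSlab`
(strip `n ≤ 183/200` by `ndnio2_M21_lowFillingCell183_below_bar`; the rest by box-2's `ObsStiffnessSeqCeilingAt_on_highSlab_of_apexStation_twoEndObjectives` with
`(U_A, U₁, U_max) = (5, 13/2, 17/2)` and the σ-chord). Families: §14 (one bundle row + cap table), §15 (glued sub-bundles), part 4 §10 (box rows), or any finer format.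
CONDITIONAL on the four families; no number asserted. [cite: KomaTasaki1994, §1] [cite: ScalapinoWhiteZhang1993, §II] [cite: BoydVandenberghe2004, §5.9] -/
theorem ndM21_residualHighUSlab_of_pricedFamilies {vPA vQA vPB vQB : ℝ → ℝ → ℝ} {c : ℚ}
    (fPA : ∀ x ∈ Set.Icc (183 / 200 : ℝ) (477 / 500), ∀ s ∈ Set.Icc (-(276 / 425) : ℝ) (-11 / 20),
      ∀ (ω : InfVolFermionState 2) (Ls : ℕ → ℕ) (ψ : ∀ L, Fock (Orb (FermionTorus 2 L))),
      Tendsto Ls atTop atTop →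
      (∀ j, IsGroundStateInSector (hubbardTorusTT' (Ls j) 1 s 5) (rectN x (Ls j)) 0 (ψ (Ls j))) →
      (∀ j, star (ψ (Ls j)) ⬝ᵥ ψ (Ls j) = 1) → ω.IsTorusLimitOf ψ Ls →
      vPA x s ≤ ((Finset.univ : Finset (DihedralGroup 4)).card : ℝ)⁻¹ * ∑ g ∈ (Finset.univ : Finset (DihedralGroup 4)),
        (ω.expect (d4ShiftSet g 0 (Literature.Probability.LatticeModels.box 2 7))
          (fermionEmbed (PolySite.d4Emb g 0 (Literature.Probability.LatticeModels.box 2 7)) (-oddMomentObsTT (-23 / 50) 5 0))).re)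
    (fQA : ∀ x ∈ Set.Icc (183 / 200 : ℝ) (477 / 500), ∀ s ∈ Set.Icc (-(276 / 425) : ℝ) (-11 / 20),
      ∀ (ω : InfVolFermionState 2) (Ls : ℕ → ℕ) (ψ : ∀ L, Fock (Orb (FermionTorus 2 L))),
      Tendsto Ls atTop atTop →
      (∀ j, IsGroundStateInSector (hubbardTorusTT' (Ls j) 1 s 5) (rectN x (Ls j)) 0 (ψ (Ls j))) →
      (∀ j, star (ψ (Ls j)) ⬝ᵥ ψ (Ls j) = 1) → ω.IsTorusLimitOf ψ Ls →
      vQA x s ≤ ((Finset.univ : Finset (DihedralGroup 4)).card : ℝ)⁻¹ * ∑ g ∈ (Finset.univ : Finset (DihedralGroup 4)),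
        (ω.expect (d4ShiftSet g 0 (Literature.Probability.LatticeModels.box 2 7))
          (fermionEmbed (PolySite.d4Emb g 0 (Literature.Probability.LatticeModels.box 2 7)) (-oddMomentObsTT (-11 / 25) 5 0))).re)
    (fPB : ∀ x ∈ Set.Icc (183 / 200 : ℝ) (477 / 500), ∀ s ∈ Set.Icc (-11 / 20 : ℝ) (-(176 / 325)),
      ∀ (ω : InfVolFermionState 2) (Ls : ℕ → ℕ) (ψ : ∀ L, Fock (Orb (FermionTorus 2 L))),
      Tendsto Ls atTop atTop →
      (∀ j, IsGroundStateInSector (hubbardTorusTT' (Ls j) 1 s 5) (rectN x (Ls j)) 0 (ψ (Ls j))) →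
      (∀ j, star (ψ (Ls j)) ⬝ᵥ ψ (Ls j) = 1) → ω.IsTorusLimitOf ψ Ls →
      vPB x s ≤ ((Finset.univ : Finset (DihedralGroup 4)).card : ℝ)⁻¹ * ∑ g ∈ (Finset.univ : Finset (DihedralGroup 4)),
        (ω.expect (d4ShiftSet g 0 (Literature.Probability.LatticeModels.box 2 7))
          (fermionEmbed (PolySite.d4Emb g 0 (Literature.Probability.LatticeModels.box 2 7)) (-oddMomentObsTT (-23 / 50) 5 0))).re)
    (fQB : ∀ x ∈ Set.Icc (183 / 200 : ℝ) (477 / 500), ∀ s ∈ Set.Icc (-11 / 20 : ℝ) (-(176 / 325)),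
      ∀ (ω : InfVolFermionState 2) (Ls : ℕ → ℕ) (ψ : ∀ L, Fock (Orb (FermionTorus 2 L))),
      Tendsto Ls atTop atTop →
      (∀ j, IsGroundStateInSector (hubbardTorusTT' (Ls j) 1 s 5) (rectN x (Ls j)) 0 (ψ (Ls j))) →
      (∀ j, star (ψ (Ls j)) ⬝ᵥ ψ (Ls j) = 1) → ω.IsTorusLimitOf ψ Ls →
      vQB x s ≤ ((Finset.univ : Finset (DihedralGroup 4)).card : ℝ)⁻¹ * ∑ g ∈ (Finset.univ : Finset (DihedralGroup 4)),
        (ω.expect (d4ShiftSet g 0 (Literature.Probability.LatticeModels.box 2 7))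
          (fermionEmbed (PolySite.d4Emb g 0 (Literature.Probability.LatticeModels.box 2 7)) (-oddMomentObsTT (-11 / 25) 5 0))).re)
    (pPA : ∀ x ∈ Set.Icc (183 / 200 : ℝ) (477 / 500), ∀ s ∈ Set.Icc (-(276 / 425) : ℝ) (-11 / 20), -vPA x s ≤ ((c : ℚ) : ℝ))
    (pQA : ∀ x ∈ Set.Icc (183 / 200 : ℝ) (477 / 500), ∀ s ∈ Set.Icc (-(276 / 425) : ℝ) (-11 / 20), -vQA x s ≤ ((c : ℚ) : ℝ))
    (pPB : ∀ x ∈ Set.Icc (183 / 200 : ℝ) (477 / 500), ∀ s ∈ Set.Icc (-11 / 20 : ℝ) (-(176 / 325)), -vPB x s ≤ ((c : ℚ) : ℝ))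
    (pQB : ∀ x ∈ Set.Icc (183 / 200 : ℝ) (477 / 500), ∀ s ∈ Set.Icc (-11 / 20 : ℝ) (-(176 / 325)), -vQB x s ≤ ((c : ℚ) : ℝ))
    (hc : c ≤ 4779578 / 10000000) :
    ∀ tp ∈ Set.Icc (-23 / 50 : ℝ) (-11 / 25), ∀ U ∈ Set.Icc (13 / 2 : ℝ) (17 / 2), ∀ n ∈ Set.Icc (9 / 10 : ℝ) (477 / 500),
      ObsStiffnessSeqCeilingAt tp U n (4779578 / 10000000) := by
  intro tp htp U hU n hn
  rcases le_total n (183 / 200) with hlow | hhigh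
  · exact ndnio2_M21_lowFillingCell183_below_bar (U := U) htp ⟨by linarith [hn.1], hlow⟩
  have hn' : n ∈ Set.Icc (183 / 200 : ℝ) (477 / 500) := ⟨hhigh, hn.2⟩
  have eL : (-23 / 50 : ℝ) * (2 - (5 : ℝ) / (17 / 2 : ℝ)) = -(276 / 425) := by norm_num
  have eR : (-11 / 25 : ℝ) * (2 - (5 : ℝ) / (13 / 2 : ℝ)) = -(176 / 325) := by norm_num
  refine (ObsStiffnessSeqCeilingAt_on_highSlab_of_apexStation_twoEndObjectives (p := -23 / 50) (q := -11 / 25) (UA := (5 : ℝ))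
    (U₁ := (13 / 2 : ℝ)) (Umax := (17 / 2 : ℝ)) (n := n) (by norm_num) (by norm_num) (by norm_num) (by norm_num)
    (by linarith [hn'.1]) (by linarith [hn'.2])
    (fun s => if s ≤ -11 / 20 then vPA n s else vPB n s) (fun s => if s ≤ -11 / 20 then vQA n s else vQB n s)
    c ?_ ?_ ?_ tp htp U hU).mono hc
  · intro s hs
    rw [eL, eR] at hs
    exact orbitFamily_glue (UA := (5 : ℝ)) fPA fPB n hn' s hs
  · intro s hs
    rw [eL, eR] at hs
    exact orbitFamily_glue (UA := (5 : ℝ)) fQA fQB n hn' s hs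
  · intro σ hσ s hs
    -- the sources of every slot lie on the station segment `[−276/425, −176/325]`
    have f₁ : (0 : ℝ) ≤ 2 - (5 : ℝ) / (17 / 2 : ℝ) := by norm_num
    have f₂ : (0 : ℝ) ≤ 2 - (5 : ℝ) / (13 / 2 : ℝ) := by norm_num
    have hs' : s ∈ Set.Icc (-(276 / 425) : ℝ) (-(176 / 325)) := by
      refine ⟨?_, ?_⟩
      · rw [← eL]; exact (mul_le_mul_of_nonneg_right hσ.1 f₁).trans hs.1
      · rw [← eR]; exact hs.2.trans (mul_le_mul_of_nonneg_right hσ.2 f₂)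
    exact neg_slotChord_le_of_neg_le (by norm_num) hσ (orbitPrice_glue pPA pPB n hn' s hs') (orbitPrice_glue pQA pQB n hn' s hs')

/-- **`ResidualLowUSlab` FROM SIX PRICED FAMILIES** (station 5; `P`, `Q` × segments A′ `[−184/325, −11/20]`, B′ `[−11/20, −23/50]`, C `[−23/50, −11/25]` × R‴): the
same with six families, `c ≤ 4779578/10⁷` ⇒ LITERALLY the statement of `Theses.CovNdNiO2M21.ResidualLowUSlab` (unc-2's
`ObsStiffnessSeqCeilingAt_on_box_of_apexStation_twoEndObjectives` with `(U_A, U_max) = (5, 13/2)`). A family on a larger rectangle (e.g. an A-bundle on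
`[−276/425, −11/20]`) restricts by `orbitFamily_mono`. CONDITIONAL on the six families; no number asserted.
[cite: KomaTasaki1994, §1] [cite: ScalapinoWhiteZhang1993, §II] [cite: BoydVandenberghe2004, §5.9] -/
theorem ndM21_residualLowUSlab_of_pricedFamilies {vPA vQA vPB vQB vPC vQC : ℝ → ℝ → ℝ} {c : ℚ}
    (fPA : ∀ x ∈ Set.Icc (183 / 200 : ℝ) (477 / 500), ∀ s ∈ Set.Icc (-(184 / 325) : ℝ) (-11 / 20),
      ∀ (ω : InfVolFermionState 2) (Ls : ℕ → ℕ) (ψ : ∀ L, Fock (Orb (FermionTorus 2 L))),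
      Tendsto Ls atTop atTop →
      (∀ j, IsGroundStateInSector (hubbardTorusTT' (Ls j) 1 s 5) (rectN x (Ls j)) 0 (ψ (Ls j))) →
      (∀ j, star (ψ (Ls j)) ⬝ᵥ ψ (Ls j) = 1) → ω.IsTorusLimitOf ψ Ls →
      vPA x s ≤ ((Finset.univ : Finset (DihedralGroup 4)).card : ℝ)⁻¹ * ∑ g ∈ (Finset.univ : Finset (DihedralGroup 4)),
        (ω.expect (d4ShiftSet g 0 (Literature.Probability.LatticeModels.box 2 7))
          (fermionEmbed (PolySite.d4Emb g 0 (Literature.Probability.LatticeModels.box 2 7)) (-oddMomentObsTT (-23 / 50) 5 0))).re)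
    (fQA : ∀ x ∈ Set.Icc (183 / 200 : ℝ) (477 / 500), ∀ s ∈ Set.Icc (-(184 / 325) : ℝ) (-11 / 20),
      ∀ (ω : InfVolFermionState 2) (Ls : ℕ → ℕ) (ψ : ∀ L, Fock (Orb (FermionTorus 2 L))),
      Tendsto Ls atTop atTop →
      (∀ j, IsGroundStateInSector (hubbardTorusTT' (Ls j) 1 s 5) (rectN x (Ls j)) 0 (ψ (Ls j))) →
      (∀ j, star (ψ (Ls j)) ⬝ᵥ ψ (Ls j) = 1) → ω.IsTorusLimitOf ψ Ls →
      vQA x s ≤ ((Finset.univ : Finset (DihedralGroup 4)).card : ℝ)⁻¹ * ∑ g ∈ (Finset.univ : Finset (DihedralGroup 4)),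
        (ω.expect (d4ShiftSet g 0 (Literature.Probability.LatticeModels.box 2 7))
          (fermionEmbed (PolySite.d4Emb g 0 (Literature.Probability.LatticeModels.box 2 7)) (-oddMomentObsTT (-11 / 25) 5 0))).re)
    (fPB : ∀ x ∈ Set.Icc (183 / 200 : ℝ) (477 / 500), ∀ s ∈ Set.Icc (-11 / 20 : ℝ) (-23 / 50),
      ∀ (ω : InfVolFermionState 2) (Ls : ℕ → ℕ) (ψ : ∀ L, Fock (Orb (FermionTorus 2 L))),
      Tendsto Ls atTop atTop →
      (∀ j, IsGroundStateInSector (hubbardTorusTT' (Ls j) 1 s 5) (rectN x (Ls j)) 0 (ψ (Ls j))) →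
      (∀ j, star (ψ (Ls j)) ⬝ᵥ ψ (Ls j) = 1) → ω.IsTorusLimitOf ψ Ls →
      vPB x s ≤ ((Finset.univ : Finset (DihedralGroup 4)).card : ℝ)⁻¹ * ∑ g ∈ (Finset.univ : Finset (DihedralGroup 4)),
        (ω.expect (d4ShiftSet g 0 (Literature.Probability.LatticeModels.box 2 7))
          (fermionEmbed (PolySite.d4Emb g 0 (Literature.Probability.LatticeModels.box 2 7)) (-oddMomentObsTT (-23 / 50) 5 0))).re)
    (fQB : ∀ x ∈ Set.Icc (183 / 200 : ℝ) (477 / 500), ∀ s ∈ Set.Icc (-11 / 20 : ℝ) (-23 / 50),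
      ∀ (ω : InfVolFermionState 2) (Ls : ℕ → ℕ) (ψ : ∀ L, Fock (Orb (FermionTorus 2 L))),
      Tendsto Ls atTop atTop →
      (∀ j, IsGroundStateInSector (hubbardTorusTT' (Ls j) 1 s 5) (rectN x (Ls j)) 0 (ψ (Ls j))) →
      (∀ j, star (ψ (Ls j)) ⬝ᵥ ψ (Ls j) = 1) → ω.IsTorusLimitOf ψ Ls →
      vQB x s ≤ ((Finset.univ : Finset (DihedralGroup 4)).card : ℝ)⁻¹ * ∑ g ∈ (Finset.univ : Finset (DihedralGroup 4)),
        (ω.expect (d4ShiftSet g 0 (Literature.Probability.LatticeModels.box 2 7))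
          (fermionEmbed (PolySite.d4Emb g 0 (Literature.Probability.LatticeModels.box 2 7)) (-oddMomentObsTT (-11 / 25) 5 0))).re)
    (fPC : ∀ x ∈ Set.Icc (183 / 200 : ℝ) (477 / 500), ∀ s ∈ Set.Icc (-23 / 50 : ℝ) (-11 / 25),
      ∀ (ω : InfVolFermionState 2) (Ls : ℕ → ℕ) (ψ : ∀ L, Fock (Orb (FermionTorus 2 L))),
      Tendsto Ls atTop atTop →
      (∀ j, IsGroundStateInSector (hubbardTorusTT' (Ls j) 1 s 5) (rectN x (Ls j)) 0 (ψ (Ls j))) →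
      (∀ j, star (ψ (Ls j)) ⬝ᵥ ψ (Ls j) = 1) → ω.IsTorusLimitOf ψ Ls →
      vPC x s ≤ ((Finset.univ : Finset (DihedralGroup 4)).card : ℝ)⁻¹ * ∑ g ∈ (Finset.univ : Finset (DihedralGroup 4)),
        (ω.expect (d4ShiftSet g 0 (Literature.Probability.LatticeModels.box 2 7))
          (fermionEmbed (PolySite.d4Emb g 0 (Literature.Probability.LatticeModels.box 2 7)) (-oddMomentObsTT (-23 / 50) 5 0))).re)
    (fQC : ∀ x ∈ Set.Icc (183 / 200 : ℝ) (477 / 500), ∀ s ∈ Set.Icc (-23 / 50 : ℝ) (-11 / 25),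
      ∀ (ω : InfVolFermionState 2) (Ls : ℕ → ℕ) (ψ : ∀ L, Fock (Orb (FermionTorus 2 L))),
      Tendsto Ls atTop atTop →
      (∀ j, IsGroundStateInSector (hubbardTorusTT' (Ls j) 1 s 5) (rectN x (Ls j)) 0 (ψ (Ls j))) →
      (∀ j, star (ψ (Ls j)) ⬝ᵥ ψ (Ls j) = 1) → ω.IsTorusLimitOf ψ Ls →
      vQC x s ≤ ((Finset.univ : Finset (DihedralGroup 4)).card : ℝ)⁻¹ * ∑ g ∈ (Finset.univ : Finset (DihedralGroup 4)),
        (ω.expect (d4ShiftSet g 0 (Literature.Probability.LatticeModels.box 2 7))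
          (fermionEmbed (PolySite.d4Emb g 0 (Literature.Probability.LatticeModels.box 2 7)) (-oddMomentObsTT (-11 / 25) 5 0))).re)
    (pPA : ∀ x ∈ Set.Icc (183 / 200 : ℝ) (477 / 500), ∀ s ∈ Set.Icc (-(184 / 325) : ℝ) (-11 / 20), -vPA x s ≤ ((c : ℚ) : ℝ))
    (pQA : ∀ x ∈ Set.Icc (183 / 200 : ℝ) (477 / 500), ∀ s ∈ Set.Icc (-(184 / 325) : ℝ) (-11 / 20), -vQA x s ≤ ((c : ℚ) : ℝ))
    (pPB : ∀ x ∈ Set.Icc (183 / 200 : ℝ) (477 / 500), ∀ s ∈ Set.Icc (-11 / 20 : ℝ) (-23 / 50), -vPB x s ≤ ((c : ℚ) : ℝ))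
    (pQB : ∀ x ∈ Set.Icc (183 / 200 : ℝ) (477 / 500), ∀ s ∈ Set.Icc (-11 / 20 : ℝ) (-23 / 50), -vQB x s ≤ ((c : ℚ) : ℝ))
    (pPC : ∀ x ∈ Set.Icc (183 / 200 : ℝ) (477 / 500), ∀ s ∈ Set.Icc (-23 / 50 : ℝ) (-11 / 25), -vPC x s ≤ ((c : ℚ) : ℝ))
    (pQC : ∀ x ∈ Set.Icc (183 / 200 : ℝ) (477 / 500), ∀ s ∈ Set.Icc (-23 / 50 : ℝ) (-11 / 25), -vQC x s ≤ ((c : ℚ) : ℝ))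
    (hc : c ≤ 4779578 / 10000000) :
    ∀ tp ∈ Set.Icc (-23 / 50 : ℝ) (-11 / 25), ∀ U ∈ Set.Icc (5 : ℝ) (13 / 2), ∀ n ∈ Set.Icc (9 / 10 : ℝ) (477 / 500),
      ObsStiffnessSeqCeilingAt tp U n (4779578 / 10000000) := by
  intro tp htp U hU n hn
  rcases le_total n (183 / 200) with hlow | hhigh
  · exact ndnio2_M21_lowFillingCell183_below_bar (U := U) htp ⟨by linarith [hn.1], hlow⟩
  have hn' : n ∈ Set.Icc (183 / 200 : ℝ) (477 / 500) := ⟨hhigh, hn.2⟩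
  have eL : (-23 / 50 : ℝ) * (2 - (5 : ℝ) / (13 / 2 : ℝ)) = -(184 / 325) := by norm_num
  -- three-piece families on `[−184/325, −11/25]`: A′ for `s ≤ −11/20`, then B′ for `s ≤ −23/50`, then C
  have gP := orbitFamily_glue (UA := (5 : ℝ)) fPA (orbitFamily_glue (UA := (5 : ℝ)) fPB fPC) n hn'
  have gQ := orbitFamily_glue (UA := (5 : ℝ)) fQA (orbitFamily_glue (UA := (5 : ℝ)) fQB fQC) n hn'
  have qP := orbitPrice_glue pPA (orbitPrice_glue pPB pPC) n hn'
  have qQ := orbitPrice_glue pQA (orbitPrice_glue pQB pQC) n hn'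
  refine (ObsStiffnessSeqCeilingAt_on_box_of_apexStation_twoEndObjectives (p := -23 / 50) (q := -11 / 25) (UA := (5 : ℝ))
    (Umax := (13 / 2 : ℝ)) (n := n) (by norm_num) (by norm_num) (by norm_num) (by linarith [hn'.1]) (by linarith [hn'.2])
    (fun s => if s ≤ -11 / 20 then vPA n s else (if s ≤ -23 / 50 then vPB n s else vPC n s))
    (fun s => if s ≤ -11 / 20 then vQA n s else (if s ≤ -23 / 50 then vQB n s else vQC n s))
    c (fun s hs => gP s (by rw [eL] at hs; exact hs)) (fun s hs => gQ s (by rw [eL] at hs; exact hs)) ?_ tp htp U hU).mono hc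
  intro σ hσ s hs
  have f₁ : (0 : ℝ) ≤ 2 - (5 : ℝ) / (13 / 2 : ℝ) := by norm_num
  have hs' : s ∈ Set.Icc (-(184 / 325) : ℝ) (-11 / 25) :=
    ⟨by rw [← eL]; exact (mul_le_mul_of_nonneg_right hσ.1 f₁).trans hs.1, hs.2.trans hσ.2⟩
  exact neg_slotChord_le_of_neg_le (by norm_num) hσ (qP s hs') (qQ s hs')

end PricedFamilies

end Summit.Ventures.CertifiedManyBodySolver.Observables

end
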